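import Summits.QuantumFields.YangMills.Theorems.BalabanLadderIRClauseILocality
import HarnessLib

/-!
# Clause (i) of the `IR` line `af-pincer-Uc`: the SHELL-PAIR reduction (L1′)

Helper module for item `stmt-QuantumFields-19354` (crux `IR`, spine route `BalabanLadder`; slot «af-pincer-Uc»
7eb42365f8aba369; `--supports`, closes nothing).  Sequel of `Theorems/BalabanLadderIRClauseILocality` (row «ClauseI LOCALITY
& MONOTONICITY» named by the line's lead prover).

`FixedMesh.ClauseI ρ β w n ε Typ` quantifies over exterior pairs `(σ, σ')` typical off `Y` on window + shell and agreeing on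
the window cells off `Y`.  For CELL-LOCAL classes (`Typ c` read on `cellEdges w c`, the slot's `TypLocal` witness conjunct)
on frames with cells of width `≥ 1` this file proves that the pair may be taken to DIFFER ONLY ON THE SHELL
`ShellTempered.shellEdges w n` (the edges of the one-cell layer outside the window):

* `clauseI_iff_shell_pairs` — `ClauseI ↔` the same demand for pairs with `σ = σ'` off `shellEdges w n`.  (Given a general
  admissible pair, transplant `σ'`'s shell datum into `σ`; the new datum is typical where `σ'` resp. `σ` is, by
  cell-locality, and gives the same `γ_{regionEdges w Y}`-mean of centre-cell cylinders as `σ'`, by the locality theorem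
  `integral_regionEdges_eq_of_agree_near` of the companion module.)
* `clauseI_iff_rim_shell_pairs` — combined with the rim reduction (`0 ≤ ε`): clause (i) is EXACTLY the insensitivity, to
  within `ε` and uniformly over typical data, of the centre-cell law under `γ_{regionEdges w Y}` to the SHELL datum, for cell
  unions `Y ∋ 0` of the window that reach the rim `|yᵢ| = 2n`.
* `clauseI_workingClass_iff_rim_shell_pairs` (§3) — the same for the line's working class `diluteTyp ∩ Typ_lx^int`
  (cell-local by the tree's `dependsOn_diluteTyp` / `typLxInt_dependsOn`): conjunct (b) of the lead's
  `ClauseIWorkingClassAtOnset`, per mesh-`b` frame, restated exactly in rim-and-shell form (+ the sufficiency direction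
  `clauseI_workingClass_of_rim_shell_pairs` for a supplier).

Pure specification bookkeeping; no research content (clause (i) itself is NOT claimed).  Conditional chain untouched; not
a gap, not Clay.  No `sorry`; axioms ⊆ {propext, Classical.choice, Quot.sound}.
-/

set_option autoImplicit false

noncomputable section

open MeasureTheory
open Literature.MathematicalPhysics.QuantumLattice
open Literature.Probability.LatticeModels
open Summit.QuantumFields.YangMills.Cruxes.IR.Tempered (cellEdges windowCells regionEdges)
open Summit.QuantumFields.YangMills.Cruxes.IR.ShellTempered (windowCellsPlus shellEdges)
open Summit.QuantumFields.YangMills.Cruxes.IR.CellTempered.Engine (frameCell frameCell_eq_iff mem_cellEdges_frameCell)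
open Summit.QuantumFields.YangMills.Cruxes.IR.AfPincerUc.Calibration (windowCells_subset_windowCellsPlus)

namespace Summit.QuantumFields.YangMills.Cruxes.IR.FixedMesh

/-! ## §1 Window cells and shell cells do not share edges -/

section Geometry

variable {w : Fin 4 → ℤ → ℤ}

/-- An edge of a window cell is not a shell edge. -/
theorem not_mem_shellEdges_of_mem_cellEdges {n : ℕ} {c : Fin 4 → ℤ} (hc : c ∈ windowCells n) {e : ZdEdge 4}
    (he : e ∈ cellEdges w c) : e ∉ shellEdges w n := by
  simp only [Summit.QuantumFields.YangMills.Cruxes.IR.ShellTempered.shellEdges, Finset.mem_sdiff, not_and, not_not]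
  exact fun _ => Finset.mem_biUnion.2 ⟨c, hc, he⟩

/-- On a frame with cells of width `≥ 1`, the edges of a cell of the enlarged window OUTSIDE the window are shell edges
(distinct cells have disjoint edge boxes, `frameCell_eq_iff`). -/
theorem cellEdges_subset_shellEdges (hw : ∀ i j, w i j + 1 ≤ w i (j + 1)) {n : ℕ} {c : Fin 4 → ℤ}
    (hcP : c ∈ windowCellsPlus n) (hcW : c ∉ windowCells n) : cellEdges w c ⊆ shellEdges w n := by
  intro e he
  simp only [Summit.QuantumFields.YangMills.Cruxes.IR.ShellTempered.shellEdges, Finset.mem_sdiff]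
  refine ⟨Finset.mem_biUnion.2 ⟨c, hcP, he⟩, fun heW => hcW ?_⟩
  obtain ⟨c', hc', he'⟩ := Finset.mem_biUnion.1 heW
  have h1 : frameCell w e = c := (frameCell_eq_iff hw e c).2 he
  have h2 : frameCell w e = c' := (frameCell_eq_iff hw e c').2 he'
  rw [← h1, h2]
  exact hc'

/-- A cell adjacent (index sup-distance `≤ 1`) to a window cell lies in the enlarged window. -/
theorem mem_windowCellsPlus_of_near {n : ℕ} {Y : Finset (Fin 4 → ℤ)} (hYw : Y ⊆ windowCells n) {c : Fin 4 → ℤ}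
    (hnear : ∃ y ∈ Y, ∀ k, |c k - y k| ≤ 1) : c ∈ windowCellsPlus n := by
  obtain ⟨y, hy, hc⟩ := hnear
  have hyw := hYw hy
  simp only [Summit.QuantumFields.YangMills.Cruxes.IR.Tempered.windowCells,
    Summit.QuantumFields.YangMills.Cruxes.IR.ShellTempered.windowCellsPlus, Fintype.mem_piFinset, Finset.mem_Icc] at hyw ⊢
  intro i
  have h1 := abs_le.1 (hc i)
  have h2 := hyw i
  constructor <;> omega

end Geometry

/-! ## §2 (L1′) The shell-pair reduction -/

section Shell

variable {N : ℕ} {G : Type} [Group G] [TopologicalSpace G] [IsTopologicalGroup G] [CompactSpace G]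
  [MeasurableSpace G] [BorelSpace G] (ρ : G →* Matrix (Fin N) (Fin N) ℂ) {w : Fin 4 → ℤ → ℤ}

/-- **Transplanting a shell datum.**  On a frame with cells of width `≥ 1`, let `Y ∋ 0` be a cell union of the window and
`(σ, σ')` a pair agreeing on the window cells off `Y` (ClauseI's agreement clause).  Then the datum
`σt := σ' on shellEdges w n, σ elsewhere` gives the same `γ_{regionEdges w Y}`-mean of every measurable cylinder of the
centre cell as `σ'`. [folklore] -/
theorem integral_regionEdges_eq_shell_transplant (hρ : Continuous ρ) (β : ℝ) (hw : ∀ i j, w i j + 1 ≤ w i (j + 1))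
    {n : ℕ} {Y : Finset (Fin 4 → ℤ)} (hYw : Y ⊆ windowCells n) (h0 : (0 : Fin 4 → ℤ) ∈ Y) {σ σ' : LGConfig 4 G}
    (hagree : ∀ c ∈ windowCellsPlus n, c ∉ Y → c ∈ windowCells n → ∀ e ∈ cellEdges w c, σ e = σ' e)
    {f : LGConfig 4 G → ℝ} (hf : IsCylinder f (cellEdges w 0)) (hfm : Measurable f) :
    ∫ U, f U ∂(ymSpecification ρ β (regionEdges w Y) σ') =
      ∫ U, f U ∂(ymSpecification ρ β (regionEdges w Y) (fun e => if e ∈ shellEdges w n then σ' e else σ e)) := by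
  refine integral_regionEdges_eq_of_agree_near ρ hρ β hw Y (fun c hcY hnear e he => ?_) hf hfm
    (fun e he heΛ => absurd (Finset.mem_biUnion.2 ⟨0, h0, he⟩) heΛ)
  have hcP : c ∈ windowCellsPlus n := mem_windowCellsPlus_of_near hYw hnear
  by_cases hcW : c ∈ windowCells n
  · have hsh : e ∉ shellEdges w n := not_mem_shellEdges_of_mem_cellEdges hcW he
    rw [if_neg hsh]
    exact (hagree c hcP hcY hcW e he).symm
  · rw [if_pos (cellEdges_subset_shellEdges hw hcP hcW he)]

/-- **(L1′) `clauseI_iff_shell_pairs` — the exterior pair may be taken to differ ONLY ON THE SHELL.**  For a cell-local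
class on window + shell (`Typ c` read on `cellEdges w c`) and a frame with cells of width `≥ 1`, `ClauseI ρ β w n ε Typ` is
EQUIVALENT to the same demand for the pairs `(σ, σ')`, typical off `Y`, with `σ = σ'` OFF `shellEdges w n`.  (Such pairs
satisfy the agreement clause; conversely transplant `σ'`'s shell datum into `σ`: typicality transfers cellwise by locality,
the kernel mean by `integral_regionEdges_eq_shell_transplant`.)  Clause (i) is thus the insensitivity of the centre-cell
law under `γ_{regionEdges w Y}` to the SHELL datum, uniformly over typical data. [folklore] -/
theorem clauseI_iff_shell_pairs (hρ : Continuous ρ) {β : ℝ} (hw : ∀ i j, w i j + 1 ≤ w i (j + 1)) {n : ℕ} {ε : ℝ}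
    {Typ : (Fin 4 → ℤ) → Set (LGConfig 4 G)}
    (hloc : ∀ c ∈ windowCellsPlus n, DependsOn (fun σ : LGConfig 4 G => σ ∈ Typ c) ↑(cellEdges w c)) :
    ClauseI ρ β w n ε Typ ↔
      ∀ Y : Finset (Fin 4 → ℤ), Y ⊆ windowCells n → (0 : Fin 4 → ℤ) ∈ Y →
        ∀ σ σ' : LGConfig 4 G,
          (∀ c ∈ windowCellsPlus n, c ∉ Y → σ ∈ Typ c ∧ σ' ∈ Typ c) →
          (∀ e ∉ shellEdges w n, σ e = σ' e) →
          ∀ f : LGConfig 4 G → ℝ, IsCylinder f (cellEdges w 0) → Measurable f → (∀ U, 0 ≤ f U ∧ f U ≤ 1) →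
            |(∫ U, f U ∂(ymSpecification ρ β (regionEdges w Y) σ)) -
              ∫ U, f U ∂(ymSpecification ρ β (regionEdges w Y) σ')| ≤ ε := by
  classical
  refine ⟨fun hI Y hYw h0 σ σ' htyp hsh f hf hfm hf01 => ?_, fun h Y hYw h0 σ σ' htyp hagree f hf hfm hf01 => ?_⟩
  · -- shell pairs agree on every window cell
    exact hI Y hYw h0 σ σ' htyp
      (fun c _ _ hcW e he => hsh e (not_mem_shellEdges_of_mem_cellEdges hcW he)) f hf hfm hf01
  · -- transplant `σ'`'s shell datum into `σ`
    set σt : LGConfig 4 G := fun e => if e ∈ shellEdges w n then σ' e else σ e with hσt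
    rw [integral_regionEdges_eq_shell_transplant ρ hρ β hw hYw h0 hagree hf hfm]
    refine h Y hYw h0 σ σt (fun c hcP hcY => ⟨(htyp c hcP hcY).1, ?_⟩) (fun e he => by simp [σt, he]) f hf hfm hf01
    by_cases hcW : c ∈ windowCells n
    · -- a window cell: `σt = σ` on its edges
      have hdep : (σt ∈ Typ c) = (σ ∈ Typ c) :=
        hloc c hcP fun e he => by
          have hsh : e ∉ shellEdges w n := not_mem_shellEdges_of_mem_cellEdges hcW (Finset.mem_coe.1 he)
          simp [σt, hsh]
      exact hdep.mpr (htyp c hcP hcY).1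
    · -- a shell cell: `σt = σ'` on its edges
      have hdep : (σt ∈ Typ c) = (σ' ∈ Typ c) :=
        hloc c hcP fun e he => by
          have hsh : e ∈ shellEdges w n := cellEdges_subset_shellEdges hw hcP hcW (Finset.mem_coe.1 he)
          simp [σt, hsh]
      exact hdep.mpr (htyp c hcP hcY).2

/-- **Rim AND shell.**  For `0 ≤ ε`, a cell-local class on window + shell and a frame with cells of width `≥ 1`:
`ClauseI ρ β w n ε Typ` is EQUIVALENT to its restriction to cell unions `Y ∋ 0` of the window REACHING THE RIM
`|yᵢ| = 2n` and to exterior pairs typical off `Y` that DIFFER ONLY ON THE SHELL.  This is the exact content of clause (i):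
the `γ_{regionEdges w Y}`-law of the centre cell must forget the shell datum across the rim cells of `Y`, to within `ε`,
uniformly over typical data (`clauseI_iff_rim` + `clauseI_iff_shell_pairs`). [folklore] -/
theorem clauseI_iff_rim_shell_pairs (hρ : Continuous ρ) {β : ℝ} (hw : ∀ i j, w i j + 1 ≤ w i (j + 1)) {n : ℕ} {ε : ℝ}
    (hε : 0 ≤ ε) {Typ : (Fin 4 → ℤ) → Set (LGConfig 4 G)}
    (hloc : ∀ c ∈ windowCellsPlus n, DependsOn (fun σ : LGConfig 4 G => σ ∈ Typ c) ↑(cellEdges w c)) :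
    ClauseI ρ β w n ε Typ ↔
      ∀ Y : Finset (Fin 4 → ℤ), Y ⊆ windowCells n → (0 : Fin 4 → ℤ) ∈ Y → (∃ y ∈ Y, ∃ i, |y i| = 2 * (n : ℤ)) →
        ∀ σ σ' : LGConfig 4 G,
          (∀ c ∈ windowCellsPlus n, c ∉ Y → σ ∈ Typ c ∧ σ' ∈ Typ c) →
          (∀ e ∉ shellEdges w n, σ e = σ' e) →
          ∀ f : LGConfig 4 G → ℝ, IsCylinder f (cellEdges w 0) → Measurable f → (∀ U, 0 ≤ f U ∧ f U ≤ 1) →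
            |(∫ U, f U ∂(ymSpecification ρ β (regionEdges w Y) σ)) -
              ∫ U, f U ∂(ymSpecification ρ β (regionEdges w Y) σ')| ≤ ε := by
  rw [clauseI_iff_shell_pairs ρ hρ hw hloc]
  refine ⟨fun h Y hYw h0 _ => h Y hYw h0, fun h Y hYw h0 σ σ' htyp hsh f hf hfm hf01 => ?_⟩
  rcases interior_or_rim hYw with hint | hrim
  · rw [influence_eq_zero_of_interior ρ hρ β hw hint
      (fun c _ _ hcW e he => hsh e (not_mem_shellEdges_of_mem_cellEdges hcW he)) hf hfm, abs_zero]
    exact hε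
  · exact h Y hYw h0 hrim σ σ' htyp hsh f hf hfm hf01

/-- The same on mesh-`b` frames (`OnsetFormatsUc.IsFrame b w`, `b ≥ 1`) for classes carrying the slot's `TypLocal`
witness conjunct. -/
theorem clauseI_iff_rim_shell_pairs_of_typLocal (hρ : Continuous ρ) {β : ℝ} {b : ℕ} (hb : 1 ≤ b)
    (hwf : OnsetFormatsUc.IsFrame b w) {n : ℕ} {ε : ℝ} (hε : 0 ≤ ε) {Typ : (Fin 4 → ℤ) → Set (LGConfig 4 G)}
    (hT : OnsetFormatsUc.TypLocal w Typ) :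
    ClauseI ρ β w n ε Typ ↔
      ∀ Y : Finset (Fin 4 → ℤ), Y ⊆ windowCells n → (0 : Fin 4 → ℤ) ∈ Y → (∃ y ∈ Y, ∃ i, |y i| = 2 * (n : ℤ)) →
        ∀ σ σ' : LGConfig 4 G,
          (∀ c ∈ windowCellsPlus n, c ∉ Y → σ ∈ Typ c ∧ σ' ∈ Typ c) →
          (∀ e ∉ shellEdges w n, σ e = σ' e) →
          ∀ f : LGConfig 4 G → ℝ, IsCylinder f (cellEdges w 0) → Measurable f → (∀ U, 0 ≤ f U ∧ f U ≤ 1) →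
            |(∫ U, f U ∂(ymSpecification ρ β (regionEdges w Y) σ)) -
              ∫ U, f U ∂(ymSpecification ρ β (regionEdges w Y) σ')| ≤ ε :=
  clauseI_iff_rim_shell_pairs ρ hρ (width_one_of_isFrame hb hwf) hε fun c _ => hT.2 c

end Shell

/-! ## §3 The working class of the line: conjunct (b) of `ClauseIWorkingClassAtOnset`, per frame, in rim-and-shell form -/

section WorkingClass

open Summit.QuantumFields.YangMills.Theorems.IRTypLocalExcess (WorkingClass typLxInt_dependsOn)
open Summit.QuantumFields.YangMills.Theorems.IRKernelLargeField (dependsOn_diluteTyp)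
open Summit.QuantumFields.YangMills.Theorems.IRRarityUpgrade (dependsOn_mem_inter)

variable {N : ℕ} {G : Type} [Group G] [TopologicalSpace G] [IsTopologicalGroup G] [CompactSpace G]
  [MeasurableSpace G] [BorelSpace G] (ρ : G →* Matrix (Fin N) (Fin N) ℂ) {w : Fin 4 → ℤ → ℤ}

/-- **Clause (i) for the WORKING CLASS `diluteTyp ∩ Typ_lx^int`, rim-and-shell form.**  On a mesh-`b` frame (`b ≥ 1`)
and for `0 ≤ ε`, the per-frame conjunct (b) `FixedMesh.ClauseI r.ρ β w n ε (WorkingClass r.ρ ℓ T Rs E w)` of the lead's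
remaining obligation `AfPincerUc.Supplier.ClauseIWorkingClassAtOnset` (`Theorems/IR/AfPincerUcOnsetReduction`) is
EQUIVALENT to: for every cell union `Y ∋ 0` of the window reaching the rim `|yᵢ| = 2n`, every exterior pair in the working
class off `Y` that differs ONLY ON THE SHELL, and every `[0,1]`-valued measurable cylinder of the centre cell, the two
`γ_{regionEdges w Y}`-means differ by at most `ε`.  (The working class is cell-local by the tree's `dependsOn_diluteTyp`,
`typLxInt_dependsOn`; no continuity or second countability is used for that.)  Nothing here bears on (b) itself. -/
theorem clauseI_workingClass_iff_rim_shell_pairs (hρ : Continuous ρ) {β : ℝ} {b : ℕ} (hb : 1 ≤ b)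
    (hwf : OnsetFormatsUc.IsFrame b w) {n : ℕ} {ε : ℝ} (hε : 0 ≤ ε) (ℓ : ℕ) (T : ℝ) (Rs : Set ℕ) (E : ℕ → ℝ) :
    ClauseI ρ β w n ε (WorkingClass ρ ℓ T Rs E w) ↔
      ∀ Y : Finset (Fin 4 → ℤ), Y ⊆ windowCells n → (0 : Fin 4 → ℤ) ∈ Y → (∃ y ∈ Y, ∃ i, |y i| = 2 * (n : ℤ)) →
        ∀ σ σ' : LGConfig 4 G,
          (∀ c ∈ windowCellsPlus n, c ∉ Y → σ ∈ WorkingClass ρ ℓ T Rs E w c ∧ σ' ∈ WorkingClass ρ ℓ T Rs E w c) →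
          (∀ e ∉ shellEdges w n, σ e = σ' e) →
          ∀ f : LGConfig 4 G → ℝ, IsCylinder f (cellEdges w 0) → Measurable f → (∀ U, 0 ≤ f U ∧ f U ≤ 1) →
            |(∫ U, f U ∂(ymSpecification ρ β (regionEdges w Y) σ)) -
              ∫ U, f U ∂(ymSpecification ρ β (regionEdges w Y) σ')| ≤ ε :=
  clauseI_iff_rim_shell_pairs ρ hρ (width_one_of_isFrame hb hwf) hε fun c _ =>
    dependsOn_mem_inter (dependsOn_diluteTyp ρ w ℓ T c) (typLxInt_dependsOn ρ w Rs E c)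

/-- **Sufficiency form for a supplier of (b).**  To establish clause (i) for the working class on a mesh-`b` frame it
suffices (for `0 ≤ ε`) to bound by `ε` the shell-sensitivity of the centre-cell law under `γ_{regionEdges w Y}` for RIM cell
unions `Y ∋ 0` and working-class pairs differing only on the shell. -/
theorem clauseI_workingClass_of_rim_shell_pairs (hρ : Continuous ρ) {β : ℝ} {b : ℕ} (hb : 1 ≤ b)
    (hwf : OnsetFormatsUc.IsFrame b w) {n : ℕ} {ε : ℝ} (hε : 0 ≤ ε) {ℓ : ℕ} {T : ℝ} {Rs : Set ℕ} {E : ℕ → ℝ}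
    (h : ∀ Y : Finset (Fin 4 → ℤ), Y ⊆ windowCells n → (0 : Fin 4 → ℤ) ∈ Y → (∃ y ∈ Y, ∃ i, |y i| = 2 * (n : ℤ)) →
        ∀ σ σ' : LGConfig 4 G,
          (∀ c ∈ windowCellsPlus n, c ∉ Y → σ ∈ WorkingClass ρ ℓ T Rs E w c ∧ σ' ∈ WorkingClass ρ ℓ T Rs E w c) →
          (∀ e ∉ shellEdges w n, σ e = σ' e) →
          ∀ f : LGConfig 4 G → ℝ, IsCylinder f (cellEdges w 0) → Measurable f → (∀ U, 0 ≤ f U ∧ f U ≤ 1) →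
            |(∫ U, f U ∂(ymSpecification ρ β (regionEdges w Y) σ)) -
              ∫ U, f U ∂(ymSpecification ρ β (regionEdges w Y) σ')| ≤ ε) :
    ClauseI ρ β w n ε (WorkingClass ρ ℓ T Rs E w) :=
  (clauseI_workingClass_iff_rim_shell_pairs ρ hρ hb hwf hε ℓ T Rs E).2 h

end WorkingClass

end Summit.QuantumFields.YangMills.Cruxes.IR.FixedMesh

end
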